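import Mathlib
import HarnessLib
import Literature.MathematicalPhysics.AQFT.OSAxiomsSchwinger
import Literature.MathematicalPhysics.QuantumLattice.SchwartzPartition
import Literature.MathematicalPhysics.QuantumLattice.SchwartzNuclearExpansionBounds

/-!
# Line `Sketch` (coupling response) of crux `HypercubicLimit`, step Z1a piece C: the single-scale
# lattice partition of unity for separated test functions

Sub-goal `separatedScaleBound` (stmt-QuantumFields-16154, registered skeleton
`Cruxes/HypercubicLimit/Lines/Sketch.lean`).  A continuous linear functional `T` on `𝓢((ℝ⁴)ⁿ, ℂ)` whose
localised versions obey the bound HLoc (for slot cutoffs `θᵢ` with pairwise disjoint supports,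
`‖T((∏ᵢ θᵢ(xᵢ)) F)‖ ≤ M Kⁿ ∏ᵢ |θᵢ|_t |F|_{nt}`) is bounded, on test functions whose support stays at
pairwise slot distances `≥ 64 ε`, by `M Kⁿ C ε^{-p} |F|_{t'}` with `p, t', C` depending on `n, t` only.

Proof.  (1) Scale `ε = 1` (`unitScaleBound`): flatten `(ℝ⁴)ⁿ ≃ ℝ^{4n}` (`exists_flatten`) and cut `F`
with the lattice partition of unity `η_β`, `β ∈ ℤ^{4n}` of `SchwartzPartition`/`SchwartzNuclearExpansion`
(`∑_{β ∈ [-R,R]^{4n}} η_β F → F` in `𝓢`, `NuclearExpansion.tendsto_sum_eta`).  A multi-index with two slots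
within `2` in every coordinate carries no mass (on `supp η_β` the two slots are within `8 < 64`,
`eta_eq_zero_of_near`); otherwise `η_β F = (∏ᵢ θ_{βᵢ}(xᵢ)) · (P_β F)` with slot cutoffs of pairwise disjoint
supports and a window `P_β = 1` on `supp η_β` (`far_piece`), so HLoc applies; `|θ_{βᵢ}|_t` grows
polynomially in `β` (`exists_theta`), `|P_β F|_{nt}` decays faster than any power
(`exists_bound_sup_seminorm_smulLeftCLM_compSubConstCLM`), and `∑_β (1 + ‖β‖)^{-8n} < ∞`.  (2) General `ε`
by rescaling: `T F = T_ε F_ε`, `F_ε = F(ε ·)` is `64`-separated and `T_ε = T ∘ (· ∘ ε⁻¹)` obeys HLoc with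
`M ε^{-4nt}` (`NuclearExpansion.schwartzNorm_compCLMOfContinuousLinearEquiv_le`); `|F_ε|_{t'} ≤ ε^{-2t'} |F|_{t'}`.
-/

noncomputable section

open scoped SchwartzMap
open MeasureTheory Filter Topology
open Literature.MathematicalPhysics.AQFT Literature.MathematicalPhysics.QuantumLattice

namespace Summit.QuantumFields.YangMills.Cruxes.HypercubicLimit.CouplingResponse

/-- Flattening coordinates `(ℝ⁴)ⁿ ≃ ℝ^{4n}`, `Λ(x)_{(i,c)} = (xᵢ)_c`. [folklore] -/
private theorem exists_flatten (n : ℕ) :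
    ∃ Λ : (Fin n → EuclideanSpace ℝ (Fin 4)) ≃L[ℝ] EuclideanSpace ℝ (Fin (n * 4)),
      ∀ x i c, Λ x (finProdFinEquiv (i, c)) = x i c := by
  refine ⟨LinearEquiv.toContinuousLinearEquiv
    { toFun := fun x => WithLp.toLp 2 fun k => x (finProdFinEquiv.symm k).1 (finProdFinEquiv.symm k).2
      map_add' := fun x y => rfl
      map_smul' := fun r x => rfl
      invFun := fun z i => WithLp.toLp 2 fun c => z (finProdFinEquiv (i, c))
      left_inv := fun x => by funext i; ext c; simp only [Equiv.symm_apply_apply]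
      right_inv := fun z => by ext k; simp only [Prod.mk.eta, Equiv.apply_symm_apply] }, fun x i c => ?_⟩
  simp only [LinearEquiv.coe_toContinuousLinearEquiv', LinearEquiv.coe_mk, LinearMap.coe_mk,
    AddHom.coe_mk, PiLp.toLp_apply, Equiv.symm_apply_apply]

/-- **Near-diagonal multi-indices carry no mass.** If two slots of `β` are within `2` in every
coordinate, the piece `η_β F` of a `64`-separated `F` vanishes: on `supp η_β` the two slots are within
`2 · 4 = 8`. [folklore] -/
private theorem eta_eq_zero_of_near {n m : ℕ} (e : Fin n × Fin 4 ≃ Fin m)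
    (Λ : (Fin n → EuclideanSpace ℝ (Fin 4)) ≃L[ℝ] EuclideanSpace ℝ (Fin m))
    (hΛ : ∀ x i c, Λ x (e (i, c)) = x i c) {F : 𝓢((Fin n → EuclideanSpace ℝ (Fin 4)), ℂ)}
    (hF : ∀ x ∈ tsupport (F : (Fin n → EuclideanSpace ℝ (Fin 4)) → ℂ), ∀ i j, i ≠ j →
      (64 : ℝ) ≤ ‖x i - x j‖)
    (β : Fin m → ℤ) {i j : Fin n} (hij : i ≠ j)
    (hnear : ∀ c, |(β (e (i, c)) : ℝ) - β (e (j, c))| ≤ 2) :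
    NuclearExpansion.eta Λ β F = 0 := by
  refine SchwartzMap.ext fun y => ?_
  show NuclearExpansion.eta Λ β F y = 0
  by_contra hy
  have hyt : y ∈ tsupport (NuclearExpansion.eta Λ β F : (Fin n → EuclideanSpace ℝ (Fin 4)) → ℂ) :=
    subset_tsupport _ hy
  have hcoord : ∀ k, (Λ y) k - (β k : ℝ) ∈ Set.Icc (-1 : ℝ) 1 :=
    NuclearExpansion.tsupport_eta_subset Λ β F hyt
  have hyF : y ∈ tsupport (F : (Fin n → EuclideanSpace ℝ (Fin 4)) → ℂ) := by
    refine tsupport_mul_subset_right (f := fun y => ((latticeBump Λ β y : ℝ) : ℂ)) ?_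
    rwa [show (fun y => ((latticeBump Λ β y : ℝ) : ℂ) * F y) = ⇑(NuclearExpansion.eta Λ β F) from
      funext fun y => (NuclearExpansion.eta_apply Λ β F y).symm]
  have h64 := hF y hyF i j hij
  have hc : ∀ c, |(y i - y j) c| ≤ 4 := by
    intro c
    have hi := hcoord (e (i, c))
    have hj := hcoord (e (j, c))
    rw [hΛ, Set.mem_Icc] at hi hj
    have h2 := abs_le.1 (hnear c)
    rw [PiLp.sub_apply, abs_le]
    constructor <;> linarith [hi.1, hi.2, hj.1, hj.2, h2.1, h2.2]
  have hnorm := EuclideanSpace.norm_le_sqrt_card_mul (y i - y j) (by norm_num : (0 : ℝ) ≤ 4) hc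
  have h4 : √(Fintype.card (Fin 4) : ℝ) = 2 := by
    rw [Fintype.card_fin, Nat.cast_ofNat, show (4 : ℝ) = 2 ^ 2 by norm_num, Real.sqrt_sq zero_le_two]
  rw [h4] at hnorm
  linarith

/-- **Slot cutoffs.** The one-slot bumps `θ_b(z) = ∏_c ρ(z_c - b_c)`, `b ∈ ℤ⁴`, as complex test
functions: supported in the cube `{|z_c - b_c| ≤ 1}` and, being translates of `θ_0`, of Schwartz norm
`|θ_b|_t ≤ C (1 + ‖b‖)^t`. [folklore] -/
private theorem exists_theta (t : ℕ) : ∃ Cθ : ℝ, 0 ≤ Cθ ∧ ∀ b : Fin 4 → ℤ,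
    ∃ θ : 𝓢(EuclideanSpace ℝ (Fin 4), ℂ),
      (∀ z, θ z = ((∏ c, pouBump (z c - b c) : ℝ) : ℂ)) ∧
      tsupport (θ : EuclideanSpace ℝ (Fin 4) → ℂ) ⊆ {z | ∀ c, |z c - (b c : ℝ)| ≤ 1} ∧
      schwartzNorm t θ ≤ Cθ * (1 + ‖intVec b‖) ^ t := by
  set Λ₄ : EuclideanSpace ℝ (Fin 4) ≃L[ℝ] EuclideanSpace ℝ (Fin 4) :=
    ContinuousLinearEquiv.refl ℝ _ with hΛ₄
  set θ₀ : 𝓢(EuclideanSpace ℝ (Fin 4), ℂ) := (NuclearExpansion.hasCompactSupport_etaFun Λ₄ 0).toSchwartzMap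
    (NuclearExpansion.contDiff_etaFun Λ₄ 0) with hθ₀
  have hval : ∀ (b : Fin 4 → ℤ) z, SchwartzMap.compSubConstCLM ℂ (intVec b) θ₀ z =
      ((latticeBump Λ₄ b z : ℝ) : ℂ) := by
    intro b z
    rw [SchwartzMap.compSubConstCLM_apply, hθ₀, HasCompactSupport.toSchwartzMap_toFun]
    show ((latticeBump Λ₄ 0 (z - intVec b) : ℝ) : ℂ) = _
    rw [show latticeBump Λ₄ 0 (z - intVec b) = latticeBump Λ₄ b z from
      (latticeBump_eq_comp_sub Λ₄ b z).symm]
  refine ⟨2 ^ t * schwartzNorm t θ₀, mul_nonneg (pow_nonneg zero_le_two _) (schwartzNorm_nonneg _ _),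
    fun b => ⟨SchwartzMap.compSubConstCLM ℂ (intVec b) θ₀, fun z => ?_, ?_, ?_⟩⟩
  · rw [hval]; rfl
  · rw [show ⇑(SchwartzMap.compSubConstCLM ℂ (intVec b) θ₀) = fun z => ((latticeBump Λ₄ b z : ℝ) : ℂ) from
      funext (hval b)]
    refine (tsupport_comp_subset (g := fun r : ℝ => (r : ℂ)) Complex.ofReal_zero (latticeBump Λ₄ b)).trans ?_
    intro z hz c
    have h := tsupport_latticeBump_subset Λ₄ b hz c
    exact abs_le.2 ⟨h.1, h.2⟩
  · calc schwartzNorm t (SchwartzMap.compSubConstCLM ℂ (intVec b) θ₀)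
        ≤ (2 * (1 + ‖intVec b‖)) ^ t * schwartzNorm t θ₀ :=
          NuclearExpansion.schwartzNorm_compSubConstCLM_le t (intVec b) θ₀
      _ = 2 ^ t * schwartzNorm t θ₀ * (1 + ‖intVec b‖) ^ t := by rw [mul_pow]; ring

/-- **Far multi-indices factor through disjoint slot cutoffs.** If every two slots of `β` differ by more
than `2` in some coordinate, then `η_β F = (∏ᵢ θ_{βᵢ}(xᵢ)) · (P_β F)` with the slot cutoffs `θ_{βᵢ}` of
`exists_theta` (pairwise disjoint supports) and the window `P_β = P₀(· - Λ⁻¹β)`, `P₀ = 1` on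
`supp η_0`; and `∏ᵢ |θ_{βᵢ}|_t ≤ K₁ⁿ (1 + ‖Λ⁻¹β‖)^{nt}`. [folklore] -/
private theorem far_piece {n m : ℕ} (t : ℕ) (e : Fin n × Fin 4 ≃ Fin m)
    (Λ : (Fin n → EuclideanSpace ℝ (Fin 4)) ≃L[ℝ] EuclideanSpace ℝ (Fin m))
    (hΛ : ∀ x i c, Λ x (e (i, c)) = x i c) {Cθ : ℝ} (hCθ : 0 ≤ Cθ)
    (hθ : ∀ b : Fin 4 → ℤ, ∃ θ : 𝓢(EuclideanSpace ℝ (Fin 4), ℂ),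
      (∀ z, θ z = ((∏ c, pouBump (z c - b c) : ℝ) : ℂ)) ∧
      tsupport (θ : EuclideanSpace ℝ (Fin 4) → ℂ) ⊆ {z | ∀ c, |z c - (b c : ℝ)| ≤ 1} ∧
      schwartzNorm t θ ≤ Cθ * (1 + ‖intVec b‖) ^ t)
    (β : Fin m → ℤ) (hfar : ∀ i j : Fin n, i ≠ j → ∃ c, (2 : ℝ) < |(β (e (i, c)) : ℝ) - β (e (j, c))|)
    (F : 𝓢((Fin n → EuclideanSpace ℝ (Fin 4)), ℂ)) :
    ∃ θ : Fin n → 𝓢(EuclideanSpace ℝ (Fin 4), ℂ),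
      (∀ i j, i ≠ j → Disjoint (tsupport (θ i : EuclideanSpace ℝ (Fin 4) → ℂ))
        (tsupport (θ j : EuclideanSpace ℝ (Fin 4) → ℂ))) ∧
      (∀ x, NuclearExpansion.eta Λ β F x = (∏ i, θ i (x i)) *
        SchwartzMap.compSubConstCLM ℂ (NuclearExpansion.latVec Λ β)
          (SchwartzMap.smulLeftCLM ℂ (NuclearExpansion.winFun Λ)
            (SchwartzMap.compSubConstCLM ℂ (-NuclearExpansion.latVec Λ β) F)) x) ∧
      ∏ i, schwartzNorm t (θ i) ≤
        (Cθ * (1 + 2 * ‖(Λ : (Fin n → EuclideanSpace ℝ (Fin 4)) →L[ℝ] EuclideanSpace ℝ (Fin m))‖) ^ t) ^ n *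
          (1 + ‖NuclearExpansion.latVec Λ β‖) ^ (n * t) := by
  obtain ⟨b, hb⟩ : ∃ b : Fin n → Fin 4 → ℤ, ∀ i c, b i c = β (e (i, c)) := ⟨_, fun _ _ => rfl⟩
  choose θ hθv hθs hθn using fun i => hθ (b i)
  refine ⟨θ, fun i j hij => ?_, fun x => ?_, ?_⟩
  · -- disjoint supports: cubes of half-side `1` around centres differing by `> 2` in a coordinate
    obtain ⟨c, hc⟩ := hfar i j hij
    rw [← hb, ← hb] at hc
    refine Set.disjoint_left.2 fun z hzi hzj => ?_
    have h1 := abs_le.1 (hθs i hzi c); have h2 := abs_le.1 (hθs j hzj c)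
    exact absurd (abs_le.2 ⟨by linarith [h1.2, h2.1], by linarith [h1.1, h2.2]⟩) (not_le.2 hc)
  · -- factorisation `η_β F = (∏ θ_{βᵢ}(xᵢ)) · P_β F`
    have hprod : (∏ i, θ i (x i)) = ((latticeBump Λ β x : ℝ) : ℂ) := by
      rw [Finset.prod_congr rfl fun i _ => hθv i (x i), ← Complex.ofReal_prod]
      congr 1
      rw [latticeBump, ← Fintype.prod_equiv e (fun p => pouBump ((Λ x) (e p) - (β (e p) : ℝ)))
        (fun k => pouBump ((Λ x) k - (β k : ℝ))) (fun _ => rfl), Fintype.prod_prod_type]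
      simp only [hΛ, hb]
    rw [hprod, SchwartzMap.compSubConstCLM_apply, SchwartzMap.smulLeftCLM_apply_apply
      ((NuclearExpansion.hasCompactSupport_winFun Λ).hasTemperateGrowth (NuclearExpansion.contDiff_winFun Λ)),
      SchwartzMap.compSubConstCLM_apply, smul_eq_mul, sub_neg_eq_add, sub_add_cancel,
      NuclearExpansion.eta_apply]
    by_cases h0 : ((latticeBump Λ β x : ℝ) : ℂ) * F x = 0
    · rw [h0, mul_left_comm, h0, mul_zero]
    · have hxt : x ∈ tsupport (NuclearExpansion.eta Λ β F : (Fin n → EuclideanSpace ℝ (Fin 4)) → ℂ) :=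
        subset_tsupport _ (by rwa [Function.mem_support, NuclearExpansion.eta_apply])
      rw [show NuclearExpansion.winFun Λ (x - NuclearExpansion.latVec Λ β) = 1 from
        NuclearExpansion.winAt_eq_one_of_mem_tsupport_eta Λ β F hxt, one_mul]
  · -- norms of the slot cutoffs
    set L : ℝ := ‖(Λ : (Fin n → EuclideanSpace ℝ (Fin 4)) →L[ℝ] EuclideanSpace ℝ (Fin m))‖ with hL
    have hL0 : 0 ≤ L := norm_nonneg _
    have ha0 : 0 ≤ ‖NuclearExpansion.latVec Λ β‖ := norm_nonneg _
    have hi : ∀ i, schwartzNorm t (θ i) ≤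
        Cθ * (1 + 2 * L) ^ t * (1 + ‖NuclearExpansion.latVec Λ β‖) ^ t := by
      intro i
      have hint : ‖intVec (b i)‖ ≤ √(Fintype.card (Fin 4) : ℝ) * (L * ‖NuclearExpansion.latVec Λ β‖) := by
        refine EuclideanSpace.norm_le_sqrt_card_mul _ (by positivity) fun c => ?_
        rw [intVec_apply, hb]
        exact NuclearExpansion.abs_coord_le_norm_latVec Λ β (e (i, c))
      have h4 : √(Fintype.card (Fin 4) : ℝ) = 2 := by
        rw [Fintype.card_fin, Nat.cast_ofNat, show (4 : ℝ) = 2 ^ 2 by norm_num,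
          Real.sqrt_sq zero_le_two]
      rw [h4] at hint
      have h1 : 1 + ‖intVec (b i)‖ ≤ (1 + 2 * L) * (1 + ‖NuclearExpansion.latVec Λ β‖) := by
        nlinarith [mul_nonneg hL0 ha0]
      calc schwartzNorm t (θ i) ≤ Cθ * (1 + ‖intVec (b i)‖) ^ t := hθn i
        _ ≤ Cθ * ((1 + 2 * L) * (1 + ‖NuclearExpansion.latVec Λ β‖)) ^ t := by gcongr
        _ = Cθ * (1 + 2 * L) ^ t * (1 + ‖NuclearExpansion.latVec Λ β‖) ^ t := by rw [mul_pow]; ring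
    calc ∏ i, schwartzNorm t (θ i)
        ≤ ∏ _i : Fin n, Cθ * (1 + 2 * L) ^ t * (1 + ‖NuclearExpansion.latVec Λ β‖) ^ t :=
          Finset.prod_le_prod (fun i _ => schwartzNorm_nonneg _ _) fun i _ => hi i
      _ = (Cθ * (1 + 2 * L) ^ t) ^ n * (1 + ‖NuclearExpansion.latVec Λ β‖) ^ (n * t) := by
          rw [Finset.prod_const, Finset.card_univ, Fintype.card_fin, mul_pow, ← pow_mul, mul_comm t n]

/-- **The bound at scale one.** If `T` obeys HLoc with constant `A`, then
`‖T F‖ ≤ A C |F|_{t'}` for every `F` whose support is `64`-separated in the slots. [folklore] -/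
private theorem unitScaleBound (n t : ℕ) : ∃ (t' : ℕ) (C : ℝ), 0 ≤ C ∧
    ∀ (T : 𝓢((Fin n → EuclideanSpace ℝ (Fin 4)), ℂ) →L[ℂ] ℂ) (A : ℝ), 0 ≤ A →
    (∀ (θ : Fin n → 𝓢(EuclideanSpace ℝ (Fin 4), ℂ)),
      (∀ i j, i ≠ j → Disjoint (tsupport (θ i : EuclideanSpace ℝ (Fin 4) → ℂ))
        (tsupport (θ j : EuclideanSpace ℝ (Fin 4) → ℂ))) →
      ∀ (G F : 𝓢((Fin n → EuclideanSpace ℝ (Fin 4)), ℂ)), (∀ x, G x = (∏ i, θ i (x i)) * F x) →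
        ‖T G‖ ≤ A * (∏ i, schwartzNorm t (θ i)) * schwartzNorm (n * t) F) →
    ∀ F : 𝓢((Fin n → EuclideanSpace ℝ (Fin 4)), ℂ),
      (∀ x ∈ tsupport (F : (Fin n → EuclideanSpace ℝ (Fin 4)) → ℂ), ∀ i j, i ≠ j →
        (64 : ℝ) ≤ ‖x i - x j‖) →
      ‖T F‖ ≤ A * C * schwartzNorm t' F := by
  obtain ⟨Λ, hΛ⟩ := exists_flatten n
  obtain ⟨Cθ, hCθ, hθ⟩ := exists_theta t
  obtain ⟨C_w, s', hC_w0, hC_w⟩ := exists_bound_sup_seminorm_smulLeftCLM_compSubConstCLM ℂ (F := ℂ)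
    (NuclearExpansion.contDiff_winFun Λ) (NuclearExpansion.hasCompactSupport_winFun Λ)
    (Finset.Iic (n * t, n * t)) (2 * (n * t) + 2 * (n * 4))
  obtain ⟨t', ht'⟩ := NuclearExpansion.sup_seminorm_le_schwartzNorm
    (V := Fin n → EuclideanSpace ℝ (Fin 4)) s'
  have hw := NuclearExpansion.summable_inv_one_add_norm_latVec_pow Λ
  set K₁ : ℝ := Cθ * (1 + 2 * ‖(Λ : (Fin n → EuclideanSpace ℝ (Fin 4)) →L[ℝ]
    EuclideanSpace ℝ (Fin (n * 4)))‖) ^ t with hK₁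
  have hK₁0 : 0 ≤ K₁ := by positivity
  set K₀ : ℝ := K₁ ^ n * 2 ^ (n * t) * C_w with hK₀
  have hK₀0 : 0 ≤ K₀ := by positivity
  set S : ℝ := ∑' β : Fin (n * 4) → ℤ, ((1 + ‖NuclearExpansion.latVec Λ β‖) ^ (2 * (n * 4)))⁻¹ with hS
  have hS0 : 0 ≤ S := tsum_nonneg fun β => by positivity
  refine ⟨t', K₀ * S, by positivity, fun T A hA hloc F hsep => ?_⟩
  have hF0 := schwartzNorm_nonneg t' F
  -- the bound on one piece `T (η_β F)`
  have hpiece : ∀ β : Fin (n * 4) → ℤ, ‖T (NuclearExpansion.eta Λ β F)‖ ≤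
      A * K₀ * ((1 + ‖NuclearExpansion.latVec Λ β‖) ^ (2 * (n * 4)))⁻¹ * schwartzNorm t' F := by
    intro β
    by_cases hnear : ∃ i j : Fin n, i ≠ j ∧
        ∀ c, |(β (finProdFinEquiv (i, c)) : ℝ) - β (finProdFinEquiv (j, c))| ≤ 2
    · obtain ⟨i, j, hij, hc⟩ := hnear
      rw [eta_eq_zero_of_near finProdFinEquiv Λ hΛ hsep β hij hc, map_zero, norm_zero]
      positivity
    push Not at hnear
    obtain ⟨θ, hdisj, hfac, hθn⟩ := far_piece t finProdFinEquiv Λ hΛ hCθ hθ β hnear F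
    set a := NuclearExpansion.latVec Λ β
    set Fa := SchwartzMap.smulLeftCLM ℂ (NuclearExpansion.winFun Λ) (SchwartzMap.compSubConstCLM ℂ (-a) F)
    have hT := hloc θ hdisj _ _ hfac
    have hFa1 : schwartzNorm (n * t) (SchwartzMap.compSubConstCLM ℂ a Fa) ≤
        (2 * (1 + ‖a‖)) ^ (n * t) * schwartzNorm (n * t) Fa :=
      NuclearExpansion.schwartzNorm_compSubConstCLM_le (n * t) a Fa
    have hkey : (1 + ‖a‖) ^ (2 * (n * t)) * schwartzNorm (n * t) Fa ≤
        C_w * schwartzNorm t' F * ((1 + ‖a‖) ^ (2 * (n * 4)))⁻¹ := by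
      rw [← div_eq_mul_inv, le_div_iff₀ (by positivity)]
      have h := hC_w (-a) F
      rw [norm_neg] at h
      calc (1 + ‖a‖) ^ (2 * (n * t)) * schwartzNorm (n * t) Fa * (1 + ‖a‖) ^ (2 * (n * 4))
          = schwartzNorm (n * t) Fa * (1 + ‖a‖) ^ (2 * (n * t) + 2 * (n * 4)) := by ring
        _ ≤ C_w * schwartzNorm t' F := h.trans (mul_le_mul_of_nonneg_left (ht' F) hC_w0)
    calc ‖T (NuclearExpansion.eta Λ β F)‖
        ≤ A * (∏ i, schwartzNorm t (θ i)) * schwartzNorm (n * t) (SchwartzMap.compSubConstCLM ℂ a Fa) := hT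
      _ ≤ A * (K₁ ^ n * (1 + ‖a‖) ^ (n * t)) * ((2 * (1 + ‖a‖)) ^ (n * t) * schwartzNorm (n * t) Fa) :=
          mul_le_mul (mul_le_mul_of_nonneg_left hθn hA) hFa1 (schwartzNorm_nonneg _ _) (by positivity)
      _ = A * K₁ ^ n * 2 ^ (n * t) * ((1 + ‖a‖) ^ (2 * (n * t)) * schwartzNorm (n * t) Fa) := by
          rw [mul_pow (2 : ℝ)]; ring
      _ ≤ A * K₁ ^ n * 2 ^ (n * t) * (C_w * schwartzNorm t' F * ((1 + ‖a‖) ^ (2 * (n * 4)))⁻¹) :=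
          mul_le_mul_of_nonneg_left hkey (by positivity)
      _ = A * K₀ * ((1 + ‖a‖) ^ (2 * (n * 4)))⁻¹ * schwartzNorm t' F := by rw [hK₀]; ring
  -- sum over a cube and pass to the limit `∑_{β ∈ [-R,R]^{4n}} η_β F → F`
  have hsumR : ∀ R : ℕ, ‖T (∑ β ∈ latticeCube (n * 4) R, NuclearExpansion.eta Λ β F)‖ ≤
      A * (K₀ * S) * schwartzNorm t' F := by
    intro R
    rw [map_sum]
    refine (norm_sum_le _ _).trans ((Finset.sum_le_sum fun β _ => hpiece β).trans ?_)
    rw [← Finset.sum_mul, ← Finset.mul_sum, ← mul_assoc A K₀ S]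
    exact mul_le_mul_of_nonneg_right (mul_le_mul_of_nonneg_left
      (hw.sum_le_tsum _ fun β _ => by positivity) (by positivity)) hF0
  have hlim : Tendsto (fun R : ℕ => ‖T (∑ β ∈ latticeCube (n * 4) R, NuclearExpansion.eta Λ β F)‖)
      atTop (𝓝 ‖T F‖) :=
    (continuous_norm.tendsto _).comp ((T.continuous.tendsto _).comp (NuclearExpansion.tendsto_sum_eta Λ F))
  exact le_of_tendsto' hlim hsumR

/-- **Dilations.** `y ↦ ε y` (`0 < ε ≤ 1`) as a continuous linear automorphism `g`; the constants
`max(1, ‖g⁻¹‖, ‖g‖)` of `schwartzNorm_compCLMOfContinuousLinearEquiv_le` for `g`, `g⁻¹` are `≤ ε⁻¹`. [folklore] -/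
private theorem exists_dilation (Y : Type*) [NormedAddCommGroup Y] [NormedSpace ℝ Y] {ε : ℝ}
    (hε : 0 < ε) (hε1 : ε ≤ 1) :
    ∃ g : Y ≃L[ℝ] Y, (∀ y, g y = ε • y) ∧ (∀ y, g.symm y = ε⁻¹ • y) ∧
      max 1 (max ‖(g.symm : Y →L[ℝ] Y)‖ ‖(g : Y →L[ℝ] Y)‖) ≤ ε⁻¹ ∧
      max 1 (max ‖(g.symm.symm : Y →L[ℝ] Y)‖ ‖(g.symm : Y →L[ℝ] Y)‖) ≤ ε⁻¹ := by
  have hε0 : ε ≠ 0 := hε.ne'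
  have hinv : 1 ≤ ε⁻¹ := (one_le_inv₀ hε).2 hε1
  set g : Y ≃L[ℝ] Y := ContinuousLinearEquiv.equivOfInverse (ε • ContinuousLinearMap.id ℝ Y)
    (ε⁻¹ • ContinuousLinearMap.id ℝ Y) (fun y => by simp [smul_smul, hε0])
    (fun y => by simp [smul_smul, hε0]) with hg
  have h1 : ‖(g : Y →L[ℝ] Y)‖ ≤ ε⁻¹ := by
    refine ContinuousLinearMap.opNorm_le_bound _ (by positivity) fun y => ?_
    rw [show (g : Y →L[ℝ] Y) y = ε • y from rfl, norm_smul, Real.norm_of_nonneg hε.le]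
    exact mul_le_mul_of_nonneg_right (hε1.trans hinv) (norm_nonneg _)
  have h2 : ‖(g.symm : Y →L[ℝ] Y)‖ ≤ ε⁻¹ := by
    refine ContinuousLinearMap.opNorm_le_bound _ (by positivity) fun y => ?_
    rw [show (g.symm : Y →L[ℝ] Y) y = ε⁻¹ • y from rfl, norm_smul,
      Real.norm_of_nonneg (inv_nonneg.2 hε.le)]
  refine ⟨g, fun y => rfl, fun y => rfl, max_le hinv (max_le h2 h1), ?_⟩
  rw [ContinuousLinearEquiv.symm_symm]
  exact max_le hinv (max_le h1 h2)

/-- **Z1a, piece C (single-scale lattice partition of unity for separated test functions).**  Let `T` be a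
continuous linear functional on `𝓢((ℝ⁴)ⁿ, ℂ)` whose localised versions obey HLoc: for slot cutoffs `θᵢ`
with pairwise disjoint supports and `G = (∏ᵢ θᵢ(xᵢ)) F`, `‖T G‖ ≤ M Kⁿ ∏ᵢ |θᵢ|_t |F|_{nt}`.  Then for
`0 < ε ≤ 1` and every compactly supported `F` whose support stays at pairwise slot distances `≥ 64 ε`,
`‖T F‖ ≤ M Kⁿ C ε^{-p} |F|_{t'}`, with `p, t', C` depending on `n, t` only (lattice partition of unity of
mesh `ε`; near-diagonal cells are empty, far cells are slot-localised; rescaling makes the `ε`-dependence an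
explicit power). [folklore] -/
theorem separatedScaleBound : ∀ n : ℕ, ∀ t : ℕ, ∃ (p t' : ℕ) (C : ℝ), 0 ≤ C ∧ ∀ (T : 𝓢((Fin n → EuclideanSpace ℝ (Fin 4)), ℂ) →L[ℂ] ℂ) (M K : ℝ), 0 ≤ M → 0 ≤ K → (∀ (θ : Fin n → 𝓢(EuclideanSpace ℝ (Fin 4), ℂ)), (∀ i j, i ≠ j → Disjoint (tsupport (θ i : EuclideanSpace ℝ (Fin 4) → ℂ)) (tsupport (θ j : EuclideanSpace ℝ (Fin 4) → ℂ))) → ∀ (G F : 𝓢((Fin n → EuclideanSpace ℝ (Fin 4)), ℂ)), (∀ x, G x = (∏ i, θ i (x i)) * F x) → ‖T G‖ ≤ M * K ^ n * (∏ i, schwartzNorm t (θ i)) * schwartzNorm (n * t) F) → ∀ ε : ℝ, 0 < ε → ε ≤ 1 → ∀ F : 𝓢((Fin n → EuclideanSpace ℝ (Fin 4)), ℂ), HasCompactSupport (F : (Fin n → EuclideanSpace ℝ (Fin 4)) → ℂ) → (∀ x ∈ tsupport (F : (Fin n → EuclideanSpace ℝ (Fin 4)) → ℂ), ∀ i j,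 i ≠ j → 64 * ε ≤ ‖x i - x j‖) → ‖T F‖ ≤ M * K ^ n * C * ε⁻¹ ^ p * schwartzNorm t' F := by
  intro n t
  obtain ⟨t', C, hC, hunit⟩ := unitScaleBound n t
  refine ⟨4 * (n * t) + 2 * t', t', C, hC, ?_⟩
  intro T M K hM hK hloc ε hε hε1 F _ hsep
  obtain ⟨D, hD, hDs, hDc, hDc'⟩ := exists_dilation (Fin n → EuclideanSpace ℝ (Fin 4)) hε hε1
  obtain ⟨d, -, hds, -, hdc'⟩ := exists_dilation (EuclideanSpace ℝ (Fin 4)) hε hε1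
  -- the pulled-back functional `T_ε = T ∘ (· ∘ ε⁻¹)` obeys HLoc with `M ε^{-4nt}`
  set T₁ : 𝓢((Fin n → EuclideanSpace ℝ (Fin 4)), ℂ) →L[ℂ] ℂ :=
    T.comp (SchwartzMap.compCLMOfContinuousLinearEquiv ℂ D.symm) with hT₁
  have hloc₁ : ∀ (θ : Fin n → 𝓢(EuclideanSpace ℝ (Fin 4), ℂ)),
      (∀ i j, i ≠ j → Disjoint (tsupport (θ i : EuclideanSpace ℝ (Fin 4) → ℂ))
        (tsupport (θ j : EuclideanSpace ℝ (Fin 4) → ℂ))) →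
      ∀ (G F : 𝓢((Fin n → EuclideanSpace ℝ (Fin 4)), ℂ)), (∀ x, G x = (∏ i, θ i (x i)) * F x) →
        ‖T₁ G‖ ≤ M * ε⁻¹ ^ (4 * (n * t)) * K ^ n * (∏ i, schwartzNorm t (θ i)) *
          schwartzNorm (n * t) F := by
    intro θ hθ G F' hG
    have hθ' : ∀ i j, i ≠ j → Disjoint
        (tsupport (SchwartzMap.compCLMOfContinuousLinearEquiv ℂ d.symm (θ i) : EuclideanSpace ℝ (Fin 4) → ℂ))
        (tsupport (SchwartzMap.compCLMOfContinuousLinearEquiv ℂ d.symm (θ j) : EuclideanSpace ℝ (Fin 4) → ℂ)) :=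
      fun i j hij => ((hθ i j hij).preimage d.symm).mono
        (tsupport_comp_subset_preimage (θ i : EuclideanSpace ℝ (Fin 4) → ℂ) d.symm.continuous)
        (tsupport_comp_subset_preimage (θ j : EuclideanSpace ℝ (Fin 4) → ℂ) d.symm.continuous)
    have hG' : ∀ x, SchwartzMap.compCLMOfContinuousLinearEquiv ℂ D.symm G x =
        (∏ i, SchwartzMap.compCLMOfContinuousLinearEquiv ℂ d.symm (θ i) (x i)) *
          SchwartzMap.compCLMOfContinuousLinearEquiv ℂ D.symm F' x := by
      intro x
      simp only [SchwartzMap.compCLMOfContinuousLinearEquiv_apply, Function.comp_apply, hG, hDs, hds,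
        Pi.smul_apply]
    have h1 := hloc _ hθ' _ _ hG'
    have h3 : schwartzNorm (n * t) (SchwartzMap.compCLMOfContinuousLinearEquiv ℂ D.symm F') ≤
        ε⁻¹ ^ (2 * (n * t)) * schwartzNorm (n * t) F' :=
      (NuclearExpansion.schwartzNorm_compCLMOfContinuousLinearEquiv_le (n * t) D.symm F').trans
        (mul_le_mul_of_nonneg_right (pow_le_pow_left₀ (by positivity) hDc' _) (schwartzNorm_nonneg _ _))
    have h4 : ∏ i, schwartzNorm t (SchwartzMap.compCLMOfContinuousLinearEquiv ℂ d.symm (θ i)) ≤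
        (ε⁻¹ ^ (2 * t)) ^ n * ∏ i, schwartzNorm t (θ i) := by
      calc ∏ i, schwartzNorm t (SchwartzMap.compCLMOfContinuousLinearEquiv ℂ d.symm (θ i))
          ≤ ∏ i, ε⁻¹ ^ (2 * t) * schwartzNorm t (θ i) :=
            Finset.prod_le_prod (fun i _ => schwartzNorm_nonneg _ _) fun i _ =>
              (NuclearExpansion.schwartzNorm_compCLMOfContinuousLinearEquiv_le t d.symm (θ i)).trans
                (mul_le_mul_of_nonneg_right (pow_le_pow_left₀ (by positivity) hdc' _)
                  (schwartzNorm_nonneg _ _))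
        _ = (ε⁻¹ ^ (2 * t)) ^ n * ∏ i, schwartzNorm t (θ i) := by
            rw [Finset.prod_mul_distrib, Finset.prod_const, Finset.card_univ, Fintype.card_fin]
    have hπ0 : 0 ≤ ∏ i, schwartzNorm t (θ i) := Finset.prod_nonneg fun i _ => schwartzNorm_nonneg _ _
    show ‖T (SchwartzMap.compCLMOfContinuousLinearEquiv ℂ D.symm G)‖ ≤ _
    calc ‖T (SchwartzMap.compCLMOfContinuousLinearEquiv ℂ D.symm G)‖
        ≤ M * K ^ n * (∏ i, schwartzNorm t (SchwartzMap.compCLMOfContinuousLinearEquiv ℂ d.symm (θ i))) *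
            schwartzNorm (n * t) (SchwartzMap.compCLMOfContinuousLinearEquiv ℂ D.symm F') := h1
      _ ≤ M * K ^ n * ((ε⁻¹ ^ (2 * t)) ^ n * ∏ i, schwartzNorm t (θ i)) *
            (ε⁻¹ ^ (2 * (n * t)) * schwartzNorm (n * t) F') :=
          mul_le_mul (mul_le_mul_of_nonneg_left h4 (by positivity)) h3 (schwartzNorm_nonneg _ _)
            (by positivity)
      _ = M * ε⁻¹ ^ (4 * (n * t)) * K ^ n * (∏ i, schwartzNorm t (θ i)) * schwartzNorm (n * t) F' := by
          ring
  -- the rescaled test function `F_ε = F(ε ·)` is `64`-separated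
  set F₁ := SchwartzMap.compCLMOfContinuousLinearEquiv ℂ D F with hF₁
  have hsep₁ : ∀ x ∈ tsupport (F₁ : (Fin n → EuclideanSpace ℝ (Fin 4)) → ℂ), ∀ i j, i ≠ j →
      (64 : ℝ) ≤ ‖x i - x j‖ := by
    intro x hx i j hij
    have hx' : D x ∈ tsupport (F : (Fin n → EuclideanSpace ℝ (Fin 4)) → ℂ) :=
      tsupport_comp_subset_preimage (F : (Fin n → EuclideanSpace ℝ (Fin 4)) → ℂ) D.continuous hx
    have h := hsep (D x) hx' i j hij
    rw [hD, Pi.smul_apply, Pi.smul_apply, ← smul_sub, norm_smul, Real.norm_of_nonneg hε.le] at h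
    nlinarith
  have hA : 0 ≤ M * ε⁻¹ ^ (4 * (n * t)) * K ^ n := by positivity
  have hmain := hunit T₁ (M * ε⁻¹ ^ (4 * (n * t)) * K ^ n) hA hloc₁ F₁ hsep₁
  have hTF : T F = T₁ F₁ := by
    show T F = T (SchwartzMap.compCLMOfContinuousLinearEquiv ℂ D.symm F₁)
    congr 1
    ext x
    simp only [hF₁, SchwartzMap.compCLMOfContinuousLinearEquiv_apply, Function.comp_apply,
      ContinuousLinearEquiv.apply_symm_apply]
  have hF₁n : schwartzNorm t' F₁ ≤ ε⁻¹ ^ (2 * t') * schwartzNorm t' F :=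
    (NuclearExpansion.schwartzNorm_compCLMOfContinuousLinearEquiv_le t' D F).trans
      (mul_le_mul_of_nonneg_right (pow_le_pow_left₀ (by positivity) hDc _) (schwartzNorm_nonneg _ _))
  rw [hTF]
  calc ‖T₁ F₁‖ ≤ M * ε⁻¹ ^ (4 * (n * t)) * K ^ n * C * schwartzNorm t' F₁ := hmain
    _ ≤ M * ε⁻¹ ^ (4 * (n * t)) * K ^ n * C * (ε⁻¹ ^ (2 * t') * schwartzNorm t' F) :=
        mul_le_mul_of_nonneg_left hF₁n (by positivity)
    _ = M * K ^ n * C * ε⁻¹ ^ (4 * (n * t) + 2 * t') * schwartzNorm t' F := by rw [pow_add]; ring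

end Summit.QuantumFields.YangMills.Cruxes.HypercubicLimit.CouplingResponse

end
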